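import Literature.IUT.LogVolume.Theorem110GenuineStepIIPinned
import Literature.IUT.LogVolume.GenuineLogThetaPoint
import HarnessLib

/-!
# [IUTchIV] Thm. 1.10, Step (ii) AT A GENUINE Θ-VOLUME DATUM `T : Cor22.ThetaVolumeDatumAt P l`

Mochizuki, *Inter-universal Teichmüller theory IV*, RIMS manuscript (Apr. 2020; = PRIMS **57** (2021)), proof of
Thm. 1.10, Step (ii), p. 24: "`log(𝔡^K) ≤ log(𝔡^K) + log(𝔣^K) ≤ … ≤ log(𝔡^{F_tpd}) + log(𝔣^{F_tpd}) + 2·log(l) + 21`".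
Thin wrapper of `Theorem110GenuineStepIIPinned.lean` in the shape the route's layer-2 junction consumes: the bound stated
for the carriers `T.F ⊆ T.K` of a genuine Θ-volume datum (abc-iut-S2's `Cor22.ThetaVolumeDatumAt`, reading v3), with
the `F_tpd`-algebra structure on `T.K` the composite `F_tpd → T.F → T.K` and all instance plumbing done here:

* `ThetaVolumeDatumAt.ndeg_differentDivisor_add_logCondOver_le` — `log(𝔡^K) + log(𝔣^K) ≤ log(𝔡^{F_tpd}) +
  log(𝔣^{F_tpd}) + log(2^13·3^3·5^2) + 2·log(l)`;
* `ThetaVolumeDatumAt.ndeg_differentDivisor_le` — `log(𝔡^K) ≤ log(𝔡^{F_tpd}) + log(𝔣^{F_tpd}) + 2·log(l) + 21`.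

Hypotheses: `λ ∈ U_X` (`P.InU`, from the binder `P ∈ UP` of `Cor22.Thm110Legendre`) and `l ≥ 7`. Theorems only; classical;
TAKES NO SIDE on [IUTchIII] Cor. 3.12.
-/

noncomputable section

open scoped Classical

namespace Literature.IUT.LogVolume

namespace Cor22

namespace ThetaVolumeDatumAt

open NumberField IsDedekindDomain Literature.NumberTheory.DiophantineGeometry.GenEll Literature.IUT.HodgeTheaters

variable {P : NFPoint} {l : ℕ} (T : ThetaVolumeDatumAt P l)

/-- **Step (ii) at the datum**: for every genuine Θ-volume datum `T` at `(P, l)` with `λ ∈ U_X` and `l ≥ 7`,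
`deg(𝔡^{K}_ADiv) + log(𝔣^{K}) ≤ log-diff(λ) + log(𝔣^{F_tpd}) + log(2^13·3^3·5^2) + 2·log(l)` for the datum's field
`K = T.K` (read as an `F_tpd`-algebra through `T.F`). [claim: Mochizuki2012, status: disputed] -/
theorem ndeg_differentDivisor_add_logCondOver_le (hU : P.InU) (h7 : 7 ≤ l) :
    (letI := T.instFieldF; letI := T.instNumberFieldF; letI := T.instAlgebraF; letI := T.instFieldK
     letI := T.instNumberFieldK; letI := T.instAlgebraK
     letI : Algebra P.F T.K := ((algebraMap T.F T.K).comp (algebraMap P.F T.F)).toAlgebra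
     ndeg T.K (differentDivisor T.K) + logCondOver P {2, l} T.K) ≤
      P.logDiff + logCondAvoid P {2, l} + (Real.log (2 ^ (12 + 1) * 3 ^ 3 * 5 ^ 2) + 2 * Real.log l) := by
  letI := T.instFieldF; letI := T.instNumberFieldF; letI := T.instAlgebraF; letI := T.instFieldK
  letI := T.instNumberFieldK; letI := T.instAlgebraK; letI := T.instFieldFbar; letI := T.instAlgebraFbar
  letI := T.instAlgebraKFbar; letI := T.instIsElliptic
  letI : Algebra P.F T.K := ((algebraMap T.F T.K).comp (algebraMap P.F T.F)).toAlgebra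
  haveI : IsScalarTower P.F T.F T.K := IsScalarTower.of_algebraMap_eq fun _ => rfl
  exact ndeg_differentDivisor_add_logCondOver_le_pinned hU T.isSubThetaField T.j_eq T.D h7

/-- **`log(𝔡^K) ≤ log(𝔡^{F_tpd}) + log(𝔣^{F_tpd}) + 2·log(l) + 21` at the datum** (p. 24; `log(𝔣^K) ≥ 0` and
`log(2^13·3^3·5^2) ≤ 21`). [claim: Mochizuki2012, status: disputed] -/
theorem ndeg_differentDivisor_le (hU : P.InU) (h7 : 7 ≤ l) :
    (letI := T.instFieldK; letI := T.instNumberFieldK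
     ndeg T.K (differentDivisor T.K)) ≤ P.logDiff + logCondAvoid P {2, l} + 2 * Real.log l + 21 := by
  letI := T.instFieldF; letI := T.instNumberFieldF; letI := T.instAlgebraF; letI := T.instFieldK
  letI := T.instNumberFieldK; letI := T.instAlgebraK
  letI : Algebra P.F T.K := ((algebraMap T.F T.K).comp (algebraMap P.F T.F)).toAlgebra
  have h := T.ndeg_differentDivisor_add_logCondOver_le hU h7
  have h0 : 0 ≤ logCondOver P {2, l} T.K := logCondOver_nonneg P {2, l} T.K
  have h21 : Real.log (2 ^ (12 + 1) * 3 ^ 3 * 5 ^ 2 : ℝ) ≤ 21 := by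
    have := log_two_pow_thirteen_mul_le
    norm_num at this ⊢
    exact this
  change ndeg T.K (differentDivisor T.K) + logCondOver P {2, l} T.K ≤ _ at h
  change ndeg T.K (differentDivisor T.K) ≤ _
  linarith

end ThetaVolumeDatumAt

end Cor22

end Literature.IUT.LogVolume

end
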